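import Summits.BirchSwinnertonDyer.BirchSwinnertonDyer.Theorems.ByReductionTypeAtTwoRankOneAtTwoBigImageOddLocalOneDoorSubsliceNegDiscTwoConverse
import Literature.NumberTheory.Automorphic.ShimuraCurveRibetTakahashiOptimalProofs
import HarnessLib

/-!
# Route ByReductionTypeAtTwo, crux `RankOneAtTwoBigImageOddLocal` (stmt-BirchSwinnertonDyer-23715), LINE v8.15/v8.16 `one_door_analytic`:
# THE PARAMETRISATION CONSTANT FLOATS — on {`Δ_W < 0`, `Ш(W)[2] = 0`} the residue is «exponent `= v₂(c)`» at a `Sel₂`-trivial transposition prime door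
# for ANY datum, so the «no odd-constant datum» population (the `2`-primary Manin question) DROPS OUT of the `Δ_W < 0` half of R₊₊

Width prover seat `bsd-line-fkl-p2` g14 (2026-08-28), `--supports stmt-BirchSwinnertonDyer-23715` (helper).  THEOREMS ONLY (no definition, no named
fact introduced, no `sorry`).  BSD is not proved by any of this; every statement is CONDITIONAL by design on PRINT named facts (Gross–Zagier `gross_zagier`,
Kolyvagin `kolyvagin`, modularity `exists_isNewformOf`, Hoffstein–Luo `HoffsteinLuo1997_exists_twist_L_one_ne_zero`), the route's four rank-`0` cruxes BY NAME,
and — for the converse direction only — the rank-`0` `2`-converse hypothesis `hconv` of `…OneDoorSubsliceNegDiscTwoConverse.lean` (OPEN at `2`).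

WHY.  R⁻₀ (`HeegnerNonDivisibilityAtSelmerTrivialPrimeDoorAtTwo`, APPEND #9) and the R₊/R₊₊ splits (APPEND #10/#11) quantify over data with ODD constant
`c`, and leave the curves WITHOUT an odd-constant datum (the `2`-primary Manin question at `4 ∣ N`) inside R₊₊.  But the door law's identity
`2m + [Δ_W<0] = s_W + s_d + t + 2s + 2·v₂(c)` is datum-covariant (`φ_D = n·φ₁ ⇒ P_D = n·P₁, c_D = n·c₁`): at a `Sel₂`-trivial transposition prime door of a
`Δ_W < 0`, `Ш(W)[2] = 0` curve (`s_W = s_d = 0`, `t = 1`, `s = 0`) it reads `m = v₂(c)` for EVERY datum.  Hence, with the exponent allowed to FLOAT with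
`v₂(c)`, the non-divisibility statement needs no odd-constant datum — one datum of level `N_W` always exists by modularity
(`nonempty_modularParametrizationData_iff_exists_isNewformOf_unconditional`) — and covers ALL of {`Δ_W < 0`, `Ш(W)[2] = 0`}:

* §1 `not_isOfFinAddOrder_of_hasTwoDivisibilityUpToTorsion` (any exponent ⟹ infinite order), `twist_entireLFunction_ne_zero_of_hasTwoDivisibilityUpToTorsion`
  (THE DOOR OPENS ITSELF at any exponent: Gross–Zagier + modularity, no `2`-converse);
* §2 **`hasLawfulDoorAtTwo_of_exponent_eq_padicVal_at`** — at a `Sel₂`-trivial transposition-admissible prime door of a `Δ_W < 0`, `Ш(W)[2] = 0` curve of analytic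
  rank `1`, ANY datum whose Heegner point has exponent `v₂(c)` is a LAWFUL door datum (modulo Gross–Zagier + modularity only); hence
  **`bsdp_two_of_exponent_eq_padicVal_at`** (`BSDp W 2`, modulo PRINT⁴ + rank-`0` cruxes);
* §3 **`bsdp_two_of_negDiscFloat`** — the FLOATING-CONSTANT R⁻ («∀ W of the slice with `Δ_W < 0`, `Ш(W)[2] = 0`, ∀ `Sel₂`-trivial transposition-admissible
  prime door, ∀ datum: exponent `= v₂(c)`», spelled out as the hypothesis `hRf`) gives `BSDp W 2` on ALL of {`Δ_W < 0`, `Ш(W)[2] = 0`} ∩ slice — NO Manin input,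
  NO odd-datum hypothesis (door by gk2-p4's unconditional supply, datum by modularity); `heegnerNonDivisibility_of_negDiscFloat` (R⁻_float ⟹ R⁻₀);
  `doorIndexLawFullCAtTwoSomeDoorOffSubslice_of_negDiscFloat_of_rest` (v8.14's residue from R⁻_float and the residue off {`Δ_W < 0`, `Ш(W)[2] = 0`} — the
  class hypothesis WITHOUT the odd-datum conjunct);
* §4 the converse (lossless): **`exponent_eq_padicVal_of_bsdp_two_of_twoConverse_at`** (`BSDp W 2` + the twin's rank-`0` `2`-converse ⟹ exponent `= v₂(c)` at
  such a door, any datum) and **`negDiscFloat_of_rankOneAtTwoBigImageOddLocal_of_twoConverse`** (R⁻_float from the crux, modulo PRINT⁴ + rank-`0` + `hconv`).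

So on the `Δ_W < 0` side the planners' third population of R₊₊ («no odd-constant datum ⟹ Manin at `4 ∣ N`», `…ResiduePlusPlusSplit.lean` R_A) is NOT a
separate mechanism: it is R⁻ with a floating exponent.  (The `Δ_W > 0` egg side is analogous with AN-13 in place of R⁻₀; not done here.)

References: [GrossZagier1986] Thm. I.6.3, V.§2; [GrossLMS1991] §§2–3, §10, Conj. 1.2; [Kolyvagin1990] Thm. A; [Zhang2014CJM] Thm. 1.1 (shape);
[MazurRubin2010] Prop. 3.3, Cor. 3.4 (i); [AbbesUllmo1996] Thm. A (what is NOT needed).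
-/

set_option autoImplicit false
-- the Theorems namespace of this sub repeats the summit name by design (D-0017 nested layout)
set_option linter.dupNamespace false

noncomputable section

open scoped Classical

namespace Summit.BirchSwinnertonDyer.BirchSwinnertonDyer.Theorems.RankOneAtTwoOneDoor

open WeierstrassCurve NumberField Literature.NumberTheory.EllipticCurves Literature.NumberTheory.EllipticCurves.ModularForms
  Summit.BirchSwinnertonDyer.Rank1Residual.F1Sign2
  Summit.BirchSwinnertonDyer.Rank1Residual.F1Sign2.TranspositionDoor
  Summit.BirchSwinnertonDyer.BirchSwinnertonDyer.Theses.ByReductionTypeAtTwo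
open Summit.BirchSwinnertonDyer.BirchSwinnertonDyer.Theorems.GenusKolyTransp (exists_transpAdmissible_door_twistSelmerTwoCard_eq_one)

/-! ### §1 Any exponent: infinite order, and the door opens itself -/

/-- **A point with a `2`-divisibility exponent has infinite order**: `P − 2^m Q ∈ tors` with `Q ∉ 2E(K) + tors`; if `P` were torsion so would be `2^m Q`,
hence `Q` (`IsOfFinAddOrder.of_nsmul`), and `Q = Q − 2·0` would be twice a point modulo torsion. [folklore] -/
theorem not_isOfFinAddOrder_of_hasTwoDivisibilityUpToTorsion (W : WeierstrassCurve ℚ) (K : Type) [Field K] [NumberField K]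
    (P : (W.baseChange K).toAffine.Point) (m : ℕ) (h : HasTwoDivisibilityUpToTorsion W K P m) : ¬ IsOfFinAddOrder P := by
  intro hP
  obtain ⟨Q, hPQ, hQ⟩ := h
  have h2mQ : IsOfFinAddOrder ((2 ^ m) • Q) := by
    have hmem : (2 ^ m) • Q ∈ AddCommGroup.torsion (W.baseChange K).toAffine.Point := by
      have e : (2 ^ m) • Q = P - (P - (2 ^ m) • Q) := by abel
      rw [e]
      exact sub_mem ((AddCommGroup.mem_torsion _).mpr hP) hPQ
    exact (AddCommGroup.mem_torsion _).mp hmem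
  have hQfin : IsOfFinAddOrder Q := IsOfFinAddOrder.of_nsmul h2mQ (pow_ne_zero m two_ne_zero)
  exact hQ ⟨0, by rw [smul_zero, sub_zero]; exact (AddCommGroup.mem_torsion _).mpr hQfin⟩

/-- **THE DOOR OPENS ITSELF AT ANY EXPONENT**: for `W` of analytic rank `1` and a Heegner point `P` over `K` with SOME `2`-divisibility exponent,
`L(W^{(d_K)}, 1) ≠ 0` — `P` has infinite order (§1), so `L'(E/K,1) ≠ 0` (Gross–Zagier) and `L'(E/K,1) = L'(E,1)·L(W^{(d_K)},1)` (modularity).  The lead's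
`twist_entireLFunction_ne_zero_of_hasTwoDivisibilityUpToTorsion_zero` is the case `m = 0`.  NO `2`-converse.  CONDITIONAL on `gross_zagier` at `(N_W, W, K)` and
`exists_isNewformOf`. [cite: GrossZagier1986, Thm. I.6.3 and V.§2] -/
theorem twist_entireLFunction_ne_zero_of_hasTwoDivisibilityUpToTorsion (hnf : exists_isNewformOf)
    (W : WeierstrassCurve ℚ) [W.IsElliptic] [W.IsGloballyMinimal] [NeZero (W.conductorNorm ℤ)] (hr : W.analyticRank = 1)
    (K : Type) [Field K] [NumberField K] (hK : IsImaginaryQuadratic K) (hGZ : gross_zagier (W.conductorNorm ℤ) W K)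
    (hHN : SatisfiesHeegnerHypothesis (W.conductorNorm ℤ) K)
    (Dt : ModularParametrizationData W (W.conductorNorm ℤ)) (H : HeegnerDatum (W.conductorNorm ℤ) (NumberField.discr K))
    (ι : K →+* ℂ) (P : (W.baseChange K).toAffine.Point)
    (hP : WeierstrassCurve.Affine.Point.map ι.toRatAlgHom P = heegnerPointComplex Dt H)
    (m : ℕ) (hm : HasTwoDivisibilityUpToTorsion W K P m) :
    (W.quadraticTwist (NumberField.discr K : ℚ)).entireLFunction 1 ≠ 0 := by
  have hmod : hasEntireLFunction_rat := hasEntireLFunction_rat_of_exists_isNewformOf hnf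
  have hPinf : ¬ IsOfFinAddOrder P := not_isOfFinAddOrder_of_hasTwoDivisibilityUpToTorsion W K P m hm
  have hPH : IsHeegnerPoint (W.conductorNorm ℤ) W K P := ⟨Dt, H, ι, hP⟩
  have hLK : LDerivEK W K ≠ 0 := (lDerivEK_ne_zero_iff_not_isOfFinAddOrder W (W.conductorNorm ℤ) K hGZ hK hHN hPH).mpr hPinf
  have hL0 : W.entireLFunction 1 = 0 := entireLFunction_one_eq_zero_of_analyticRank_eq_one hr
  rw [lDerivEK_eq_deriv_mul_of_entireLFunction_one_eq_zero hmod W K hL0] at hLK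
  exact (mul_ne_zero_iff.mp hLK).2

/-! ### §2 Exponent `v₂(c)` at a `Sel₂`-trivial transposition prime door is a LAWFUL datum, for any constant -/

/-- The lawful identity at a minimal `Δ_W < 0` door with `2`-torsion-free `Ш`'s and exponent `v₂(c)`: `2·v₂(c) + 1 = 0 + 0 + 1 + 0 + 2·v₂(c)`
(import-free arithmetic). [cite: GrossLMS1991, Prop. 2.1 and §10] -/
theorem lawful_identity_at_padicVal (W : WeierstrassCurve ℚ) [W.IsGloballyMinimal] (d : ℤ) (c : ℤ) (sW sd : ℕ) (hΔ : W.Δ < 0)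
    (hmin : transpCount W d + 2 * identCount W d = (if W.Δ < 0 then 1 else 0)) (hsW : sW = 0) (hsd : sd = 0) :
    2 * padicValInt 2 c + (if W.Δ < 0 then 1 else 0) = sW + sd + transpCount W d + 2 * identCount W d + 2 * padicValInt 2 c := by
  rw [if_pos hΔ] at hmin ⊢
  omega

/-- **EXPONENT `v₂(c)` AT A `Sel₂`-TRIVIAL TRANSPOSITION-ADMISSIBLE PRIME DOOR IS A LAWFUL DOOR DATUM — FOR ANY PARAMETRISATION CONSTANT.**  `W/ℚ` globally
minimal of analytic rank `1` with `Δ_W < 0` and `Ш(W)[2] = 0`; `K` imaginary quadratic with `(d_K, q₀)` transposition-admissible (door-admissible and MINIMAL: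
`t = 1`, `s = 0`) and `#Sel₂(W^{(d_K)}) = 1` (so `Ш(Wd)[2^∞] = 0` on any model, `twist_arith_of_selmerTrivial`); `Dt` a datum of level `N_W` of ANY constant
`c`, `H`, `ι`, `P` over the complex Heegner point with `HasTwoDivisibilityUpToTorsion W K P (v₂ c)`.  THEN `W` admits a lawful door datum: the door opens itself
(§1), a globally minimal model of the twist exists, and the identity holds with `m = v₂(c)`.  CONDITIONAL on `gross_zagier` at `K` and `exists_isNewformOf`
only; BSD is not proved by this. [cite: GrossZagier1986, Thm. I.6.3 and V.§2] [cite: GrossLMS1991, §§2–3 and §10] [cite: MazurRubin2010, Cor. 3.4 (i)] -/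
theorem hasLawfulDoorAtTwo_of_exponent_eq_padicVal_at (hnf : exists_isNewformOf)
    (W : WeierstrassCurve ℚ) [W.IsElliptic] [W.IsGloballyMinimal] [NeZero (W.conductorNorm ℤ)] (hr : W.analyticRank = 1)
    (hΔ : W.Δ < 0) (hSha : ShaTwoTrivial W)
    (K : Type) [iF : Field K] [iN : NumberField K] (hK : IsImaginaryQuadratic K) (hGZ : gross_zagier (W.conductorNorm ℤ) W K)
    {q₀ : ℕ} [Fact q₀.Prime] (htr : TranspAdmissible W (NumberField.discr K) q₀) (hsel : twistSelmerTwoCard W (NumberField.discr K) = 1)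
    (Dt : ModularParametrizationData W (W.conductorNorm ℤ)) (H : HeegnerDatum (W.conductorNorm ℤ) (NumberField.discr K)) (ι : K →+* ℂ)
    (P : (W.baseChange K).toAffine.Point) (hP : WeierstrassCurve.Affine.Point.map ι.toRatAlgHom P = heegnerPointComplex Dt H)
    (hm : HasTwoDivisibilityUpToTorsion W K P (padicValInt 2 Dt.c)) : HasLawfulDoorAtTwo W := by
  have hadm : DoorAdmissible W (NumberField.discr K) := ANg16.doorAdmissible_of_transpAdmissible W htr
  have hmin : transpCount W (NumberField.discr K) + 2 * identCount W (NumberField.discr K) = (if W.Δ < 0 then 1 else 0) :=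
    minimal_of_transpAdmissible W htr hΔ
  have hHN : SatisfiesHeegnerHypothesis (W.conductorNorm ℤ) K := satisfiesHeegnerHypothesis_of_doorAdmissible W K hK hadm
  -- the door opens itself
  have hLt : (W.quadraticTwist (NumberField.discr K : ℚ)).entireLFunction 1 ≠ 0 :=
    twist_entireLFunction_ne_zero_of_hasTwoDivisibilityUpToTorsion hnf W hr K hK hGZ hHN Dt H ι P hP _ hm
  -- a globally minimal model of the twist; its `Ш[2^∞]` vanishes (`Sel₂ = 0`), as does `Ш(W)[2^∞]` (`Ш(W)[2] = 0`)
  have hD0 : (NumberField.discr K : ℚ) ≠ 0 := by exact_mod_cast NumberField.discr_ne_zero K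
  haveI hEt : (W.quadraticTwist (NumberField.discr K : ℚ)).IsElliptic := W.isElliptic_quadraticTwist hD0
  obtain ⟨Cd, hCd⟩ := hasGlobalMinimalModel_rat_holds (W.quadraticTwist (NumberField.discr K : ℚ))
  haveI := hCd
  obtain ⟨-, -, hbotd⟩ := twist_arith_of_selmerTrivial W hD0 hsel (Cd • W.quadraticTwist (NumberField.discr K : ℚ)) Cd rfl
  have hsd : padicValNat 2 (Nat.card (AddCommGroup.primaryComponent (Cd • W.quadraticTwist (NumberField.discr K : ℚ)).sha 2)) = 0 := by
    rw [hbotd, AddSubgroup.card_bot]; simp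
  have hsW : padicValNat 2 (Nat.card (AddCommGroup.primaryComponent W.sha 2)) = 0 :=
    padicValNat_card_primaryComponent_sha_two_eq_zero_of_shaTwoTrivial W hSha
  unfold HasLawfulDoorAtTwo
  exact ⟨K, iF, iN, hK, hadm, hLt, Dt, H, ι, P, Cd • W.quadraticTwist (NumberField.discr K : ℚ), inferInstance, hCd, Cd, hP, rfl,
    padicValInt 2 Dt.c, hm, lawful_identity_at_padicVal W (NumberField.discr K) Dt.c _ _ hΔ hmin hsW hsd⟩

/-- **`BSDp W 2` FROM EXPONENT `v₂(c)` AT A `Sel₂`-TRIVIAL TRANSPOSITION PRIME DOOR, ANY DATUM**, modulo the four primary printed facts and the route's four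
rank-`0` cruxes BY NAME: the previous lawful datum fed to `bsdp_two_of_hasLawfulDoorAtTwo_of_rankZero_cruxes`.  CONDITIONAL by design; BSD is not proved by this.
[cite: GrossZagier1986, Thm. I.6.3 and V.§2] [cite: GrossLMS1991, Conj. 1.2 and §3] [cite: Kolyvagin1990, Thm. A] -/
theorem bsdp_two_of_exponent_eq_padicVal_at
    (hGZ : ∀ (N : ℕ) [NeZero N] (W : WeierstrassCurve ℚ) (K : Type) [Field K] [NumberField K], gross_zagier N W K)
    (hKo : ∀ (N : ℕ) [NeZero N] (W : WeierstrassCurve ℚ) (K : Type) [Field K] [NumberField K], kolyvagin N W K)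
    (hnf : exists_isNewformOf) (hHL : HoffsteinLuo1997_exists_twist_L_one_ne_zero)
    (hZ4 : GoodOrdinaryRankZeroAtTwo ∧ MultiplicativeRankZeroAtTwo ∧ SupersingularRankZeroAtTwo ∧ AdditiveRankZeroAtTwo)
    (W : WeierstrassCurve ℚ) [W.IsElliptic] [W.IsGloballyMinimal] [NeZero (W.conductorNorm ℤ)]
    (hCM : ¬ W.HasCM) (hT : Odd W.torsionOrder) (hc : Odd W.tamagawaProduct) (hr : W.analyticRank = 1) (hΔ : W.Δ < 0) (hSha : ShaTwoTrivial W)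
    (K : Type) [Field K] [NumberField K] (hK : IsImaginaryQuadratic K)
    {q₀ : ℕ} [Fact q₀.Prime] (htr : TranspAdmissible W (NumberField.discr K) q₀) (hsel : twistSelmerTwoCard W (NumberField.discr K) = 1)
    (Dt : ModularParametrizationData W (W.conductorNorm ℤ)) (H : HeegnerDatum (W.conductorNorm ℤ) (NumberField.discr K)) (ι : K →+* ℂ)
    (P : (W.baseChange K).toAffine.Point) (hP : WeierstrassCurve.Affine.Point.map ι.toRatAlgHom P = heegnerPointComplex Dt H)
    (hm : HasTwoDivisibilityUpToTorsion W K P (padicValInt 2 Dt.c)) : BSDp W 2 :=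
  bsdp_two_of_hasLawfulDoorAtTwo_of_rankZero_cruxes hGZ hKo hnf hHL hZ4 W hCM hT hc hr
    (hasLawfulDoorAtTwo_of_exponent_eq_padicVal_at hnf W hr hΔ hSha K hK (hGZ _ W K) htr hsel Dt H ι P hP hm)

/-! ### §3 The floating-constant R⁻ covers ALL of {`Δ_W < 0`, `Ш(W)[2] = 0`}: no Manin input -/

/-- **`BSDp W 2` ON ALL OF {`Δ_W < 0`, `Ш(W)[2] = 0`} ∩ slice FROM THE FLOATING-CONSTANT R⁻** (`hRf`: at every `Sel₂`-trivial transposition-admissible prime door of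
such a curve, the Heegner point over ANY datum has exponent `v₂(c)`), modulo the four primary printed facts and the route's four rank-`0` cruxes — NO odd-constant
datum, NO Manin input: the door is supplied unconditionally (gk2-p4's `exists_transpAdmissible_door_twistSelmerTwoCard_eq_one`, `rank E(ℚ) = 1` from print), a
datum of level `N_W` exists by modularity (`nonempty_modularParametrizationData_iff_exists_isNewformOf_unconditional`), the `K`-rational Heegner point by
`heegnerPointComplex_mem_range_map_holds`, and §2 concludes.  CONDITIONAL by design; nothing is asserted about `hRf` (conjecture-grade: Kolyvagin's conjecture at
`2` with floating exponent); BSD is not proved by this. [cite: Zhang2014CJM, Thm. 1.1 (shape)] [cite: GrossZagier1986, Thm. I.6.3 and V.§2]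
[cite: MazurRubin2010, Prop. 3.3 and Cor. 3.4 (i)] -/
theorem bsdp_two_of_negDiscFloat
    (hGZ : ∀ (N : ℕ) [NeZero N] (W : WeierstrassCurve ℚ) (K : Type) [Field K] [NumberField K], gross_zagier N W K)
    (hKo : ∀ (N : ℕ) [NeZero N] (W : WeierstrassCurve ℚ) (K : Type) [Field K] [NumberField K], kolyvagin N W K)
    (hnf : exists_isNewformOf) (hHL : HoffsteinLuo1997_exists_twist_L_one_ne_zero)
    (hZ4 : GoodOrdinaryRankZeroAtTwo ∧ MultiplicativeRankZeroAtTwo ∧ SupersingularRankZeroAtTwo ∧ AdditiveRankZeroAtTwo)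
    (hRf : ∀ (W : WeierstrassCurve ℚ) [W.IsElliptic] [W.IsGloballyMinimal] [NeZero (W.conductorNorm ℤ)],
      ¬ W.HasCM → (∀ n : ℕ, W.HasSurjectiveModNGaloisRep ((2 ^ n : ℕ) : ℤ)) → Odd W.torsionOrder → Odd W.tamagawaProduct →
      W.analyticRank = 1 → W.Δ < 0 → ShaTwoTrivial W →
      ∀ (K : Type) [Field K] [NumberField K], IsImaginaryQuadratic K →
        ∀ (q₀ : ℕ) [Fact q₀.Prime], TranspAdmissible W (NumberField.discr K) q₀ → twistSelmerTwoCard W (NumberField.discr K) = 1 →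
          ∀ (Dt : ModularParametrizationData W (W.conductorNorm ℤ)) (H : HeegnerDatum (W.conductorNorm ℤ) (NumberField.discr K)) (ι : K →+* ℂ)
            (P : (W.baseChange K).toAffine.Point),
            WeierstrassCurve.Affine.Point.map ι.toRatAlgHom P = heegnerPointComplex Dt H →
            HasTwoDivisibilityUpToTorsion W K P (padicValInt 2 Dt.c))
    (W : WeierstrassCurve ℚ) [W.IsElliptic] [W.IsGloballyMinimal] [NeZero (W.conductorNorm ℤ)]
    (hCM : ¬ W.HasCM) (hsurj : ∀ n : ℕ, W.HasSurjectiveModNGaloisRep ((2 ^ n : ℕ) : ℤ)) (hT : Odd W.torsionOrder)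
    (hc : Odd W.tamagawaProduct) (hr : W.analyticRank = 1) (hΔ : W.Δ < 0) (hSha : ShaTwoTrivial W) : BSDp W 2 := by
  have hT2 : NoRationalTwoTorsion W := noRationalTwoTorsion_of_odd_torsionOrder W hT
  have hrQ : W.mordellWeilRank = 1 := (mordellWeilRank_eq_one_of_analyticRank_eq_one_of_isGloballyMinimal hGZ hKo hnf hHL W hr).1
  -- the door (unconditional supply) and a datum (modularity)
  obtain ⟨K, iF, iN, q₀, iq, hK, htr, -, -, hHN, hsel⟩ := exists_transpAdmissible_door_twistSelmerTwoCard_eq_one W hΔ hT2 hrQ hSha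
  obtain ⟨Dt⟩ := (nonempty_modularParametrizationData_iff_exists_isNewformOf_unconditional.mpr hnf) W
  obtain ⟨H, -⟩ :=
    nonempty_heegnerDatum_holds (W.conductorNorm ℤ) K hK (exists_dvd_sq_sub_discr_holds (W.conductorNorm ℤ) K hK hHN).choose_spec
  obtain ⟨ι⟩ : Nonempty (K →+* ℂ) := inferInstance
  obtain ⟨P, hP⟩ := heegnerPointComplex_mem_range_map_holds (W.conductorNorm ℤ) W K hK hHN Dt H ι
  exact bsdp_two_of_exponent_eq_padicVal_at hGZ hKo hnf hHL hZ4 W hCM hT hc hr hΔ hSha K hK htr hsel Dt H ι P hP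
    (hRf W hCM hsurj hT hc hr hΔ hSha K hK q₀ htr hsel Dt H ι P hP)

/-- **R⁻_float ⟹ R⁻₀** (an odd constant has `v₂(c) = 0`). [cite: GrossLMS1991, §10] -/
theorem heegnerNonDivisibility_of_negDiscFloat
    (hRf : ∀ (W : WeierstrassCurve ℚ) [W.IsElliptic] [W.IsGloballyMinimal] [NeZero (W.conductorNorm ℤ)],
      ¬ W.HasCM → (∀ n : ℕ, W.HasSurjectiveModNGaloisRep ((2 ^ n : ℕ) : ℤ)) → Odd W.torsionOrder → Odd W.tamagawaProduct →
      W.analyticRank = 1 → W.Δ < 0 → ShaTwoTrivial W →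
      ∀ (K : Type) [Field K] [NumberField K], IsImaginaryQuadratic K →
        ∀ (q₀ : ℕ) [Fact q₀.Prime], TranspAdmissible W (NumberField.discr K) q₀ → twistSelmerTwoCard W (NumberField.discr K) = 1 →
          ∀ (Dt : ModularParametrizationData W (W.conductorNorm ℤ)) (H : HeegnerDatum (W.conductorNorm ℤ) (NumberField.discr K)) (ι : K →+* ℂ)
            (P : (W.baseChange K).toAffine.Point),
            WeierstrassCurve.Affine.Point.map ι.toRatAlgHom P = heegnerPointComplex Dt H →
            HasTwoDivisibilityUpToTorsion W K P (padicValInt 2 Dt.c)) :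
    HeegnerNonDivisibilityAtSelmerTrivialPrimeDoorAtTwo := by
  intro W _ _ _ hCM hsurj hT hc hr hΔ hSha K _ _ hK q₀ _ htr _ _ _ hsel Dt H ι P hP hodd
  have hc2 : ¬ (2 : ℤ) ∣ Dt.c := fun h => Int.not_even_iff_odd.mpr hodd (even_iff_two_dvd.mpr h)
  have h0 : padicValInt 2 Dt.c = 0 := padicValInt.eq_zero_of_not_dvd hc2
  have h := hRf W hCM hsurj hT hc hr hΔ hSha K hK q₀ htr hsel Dt H ι P hP
  rwa [h0] at h

/-- **v8.14's residue from R⁻_float and the residue OFF {`Δ_W < 0`, `Ш(W)[2] = 0`} (NO odd-datum conjunct in the class).**  With R⁻_float the whole class lies on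
the sub-slice side of the accounting (`BSDp W 2`, hence a lawful datum, `hasLawfulDoorAtTwo_of_bsdp_two`), so the residue off it suffices: the v8.15 split with its
Manin conjunct REMOVED.  CONDITIONAL by design (PRINT⁴ + rank-`0` cruxes as hypotheses); BSD is not proved by this. [cite: GrossLMS1991, Conj. 1.2, §3 and §10]
[cite: Zhang2014CJM, Thm. 1.1 (shape)] -/
theorem doorIndexLawFullCAtTwoSomeDoorOffSubslice_of_negDiscFloat_of_rest
    (hGZ : ∀ (N : ℕ) [NeZero N] (W : WeierstrassCurve ℚ) (K : Type) [Field K] [NumberField K], gross_zagier N W K)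
    (hKo : ∀ (N : ℕ) [NeZero N] (W : WeierstrassCurve ℚ) (K : Type) [Field K] [NumberField K], kolyvagin N W K)
    (hnf : exists_isNewformOf) (hHL : HoffsteinLuo1997_exists_twist_L_one_ne_zero)
    (hZ4 : GoodOrdinaryRankZeroAtTwo ∧ MultiplicativeRankZeroAtTwo ∧ SupersingularRankZeroAtTwo ∧ AdditiveRankZeroAtTwo)
    (hRf : ∀ (W : WeierstrassCurve ℚ) [W.IsElliptic] [W.IsGloballyMinimal] [NeZero (W.conductorNorm ℤ)],
      ¬ W.HasCM → (∀ n : ℕ, W.HasSurjectiveModNGaloisRep ((2 ^ n : ℕ) : ℤ)) → Odd W.torsionOrder → Odd W.tamagawaProduct →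
      W.analyticRank = 1 → W.Δ < 0 → ShaTwoTrivial W →
      ∀ (K : Type) [Field K] [NumberField K], IsImaginaryQuadratic K →
        ∀ (q₀ : ℕ) [Fact q₀.Prime], TranspAdmissible W (NumberField.discr K) q₀ → twistSelmerTwoCard W (NumberField.discr K) = 1 →
          ∀ (Dt : ModularParametrizationData W (W.conductorNorm ℤ)) (H : HeegnerDatum (W.conductorNorm ℤ) (NumberField.discr K)) (ι : K →+* ℂ)
            (P : (W.baseChange K).toAffine.Point),
            WeierstrassCurve.Affine.Point.map ι.toRatAlgHom P = heegnerPointComplex Dt H →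
            HasTwoDivisibilityUpToTorsion W K P (padicValInt 2 Dt.c))
    (hrest : ∀ (W : WeierstrassCurve ℚ) [W.IsElliptic] [W.IsGloballyMinimal] [NeZero (W.conductorNorm ℤ)],
      ¬ W.HasCM → (∀ n : ℕ, W.HasSurjectiveModNGaloisRep ((2 ^ n : ℕ) : ℤ)) → Odd W.torsionOrder → Odd W.tamagawaProduct →
      W.analyticRank = 1 → ¬ HasBottomRungDoorAtTwo W → ¬ (W.Δ < 0 ∧ ShaTwoTrivial W) → HasLawfulDoorAtTwo W) :
    DoorIndexLawFullCAtTwoSomeDoorOffSubslice := by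
  intro W _ _ _ hCM hsurj hT hc hr hoff
  by_cases hcls : W.Δ < 0 ∧ ShaTwoTrivial W
  · exact hasLawfulDoorAtTwo_of_bsdp_two hGZ hKo hnf hHL (fun V _ _ hVCM hV0 => bsdp_two_of_rankZero_cruxes hZ4 V hVCM hV0) W hCM hT hc hr
      (bsdp_two_of_negDiscFloat hGZ hKo hnf hHL hZ4 hRf W hCM hsurj hT hc hr hcls.1 hcls.2)
  · exact hrest W hCM hsurj hT hc hr hoff hcls

/-! ### §4 The converse: exponent `v₂(c)` from `BSD₂(W)` and the twin's rank-`0` `2`-converse (lossless) -/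

/-- **`BSDp W 2` + the twin's rank-`0` `2`-converse ⟹ exponent `v₂(c)`** at a `Sel₂`-trivial transposition-admissible prime door, ANY datum: the twin has
corank `0`, hence (converse) analytic rank `0`, the door is open and `BSDp Wd 2` holds (`S_rankZeroTwin`); the per-datum kernel iff
`bsdp_two_iff_doorLawFullC_at_of_rank` gives SOME exponent `m` with `2m + 1 = 0 + 0 + 1 + 0 + 2·v₂(c)`, i.e. `m = v₂(c)`.  The generalisation of the lead's
`hasTwoDivisibilityUpToTorsion_zero_of_bsdp_two_at_transpDoor` (odd `c`) to every constant.  CONDITIONAL by design; BSD is not proved by this.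
[cite: Zhang2014CJM, Thm. 1.1 (shape)] [cite: GrossZagier1986, Thm. I.6.3 and V.§2] [cite: BurungaleSkinnerTianWan2024, Thm. 4.3 (p odd)] -/
theorem exponent_eq_padicVal_of_bsdp_two_of_twoConverse_at
    (hGZ : ∀ (N : ℕ) [NeZero N] (W : WeierstrassCurve ℚ) (K : Type) [Field K] [NumberField K], gross_zagier N W K)
    (hKo : ∀ (N : ℕ) [NeZero N] (W : WeierstrassCurve ℚ) (K : Type) [Field K] [NumberField K], kolyvagin N W K)
    (hnf : exists_isNewformOf) (hHL : HoffsteinLuo1997_exists_twist_L_one_ne_zero) (hZ : S_rankZeroTwin)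
    (W : WeierstrassCurve ℚ) [W.IsElliptic] [W.IsGloballyMinimal] [NeZero (W.conductorNorm ℤ)]
    (hCM : ¬ W.HasCM) (hT : Odd W.torsionOrder) (hc : Odd W.tamagawaProduct) (hr : W.analyticRank = 1)
    (hΔ : W.Δ < 0) (hSha : ShaTwoTrivial W) (hB : BSDp W 2)
    (K : Type) [Field K] [NumberField K] (hK : IsImaginaryQuadratic K) (q₀ : ℕ) [Fact q₀.Prime]
    (htr : TranspAdmissible W (NumberField.discr K) q₀) (hsel : twistSelmerTwoCard W (NumberField.discr K) = 1)
    (Dt : ModularParametrizationData W (W.conductorNorm ℤ)) (H : HeegnerDatum (W.conductorNorm ℤ) (NumberField.discr K)) (ι : K →+* ℂ)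
    (P : (W.baseChange K).toAffine.Point) (hP : WeierstrassCurve.Affine.Point.map ι.toRatAlgHom P = heegnerPointComplex Dt H)
    (Wd : WeierstrassCurve ℚ) [Wd.IsElliptic] [Wd.IsGloballyMinimal] (Cd : VariableChange ℚ)
    (hWd : Cd • W.quadraticTwist (NumberField.discr K : ℚ) = Wd) (hconv : ¬ Wd.HasCM → Wd.selmerCorank 2 = 0 → Wd.analyticRank = 0) :
    HasTwoDivisibilityUpToTorsion W K P (padicValInt 2 Dt.c) := by
  have hmod : hasEntireLFunction_rat := hasEntireLFunction_rat_of_exists_isNewformOf hnf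
  have hrQ : W.mordellWeilRank = 1 := (mordellWeilRank_eq_one_of_analyticRank_eq_one_of_isGloballyMinimal hGZ hKo hnf hHL W hr).1
  have hadm : DoorAdmissible W (NumberField.discr K) := ANg16.doorAdmissible_of_transpAdmissible W htr
  have hmin : transpCount W (NumberField.discr K) + 2 * identCount W (NumberField.discr K) = (if W.Δ < 0 then 1 else 0) :=
    minimal_of_transpAdmissible W htr hΔ
  have hHN : SatisfiesHeegnerHypothesis (W.conductorNorm ℤ) K := satisfiesHeegnerHypothesis_of_doorAdmissible W K hK hadm
  -- the twin: non-CM, corank `0`, analytic rank `0`, door open, `BSD₂(Wd)`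
  have hD0 : (NumberField.discr K : ℚ) ≠ 0 := by exact_mod_cast NumberField.discr_ne_zero K
  haveI hEt : (W.quadraticTwist (NumberField.discr K : ℚ)).IsElliptic := W.isElliptic_quadraticTwist hD0
  have hCMd : ¬ Wd.HasCM := RamifiedPairUpperBound.not_hasCM_of_smul_quadraticTwist_eq hD0 hWd hCM
  have hrd : Wd.analyticRank = 0 := hconv hCMd (twin_selmerCorank_two_eq_zero_of_twistSelmerTwoCard_eq_one W hsel Wd Cd hWd)
  have hLeq : Wd.entireLFunction = (W.quadraticTwist (NumberField.discr K : ℚ)).entireLFunction := by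
    rw [← hWd, entireLFunction_smul]
  have hLt : (W.quadraticTwist (NumberField.discr K : ℚ)).entireLFunction 1 ≠ 0 := by
    rw [← hLeq]
    exact (Wd.analyticRank_eq_zero_iff_holds (hmod Wd)).1 hrd
  have hBd : BSDp Wd 2 := hZ Wd hCMd hrd
  -- `BSD₂(W)` at the datum: some exponent with the identity
  obtain ⟨-, -, hiff⟩ :=
    bsdp_two_iff_doorLawFullC_at_of_rank hmod doorTwistTamagawaAtTwo W hT hc hr hrQ K hK (hGZ _ W K) (hKo _ W K) hadm hHN hLt Dt H ι P hP Wd Cd hWd hBd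
  obtain ⟨m, hm, hlaw⟩ := hiff.mp hB
  -- `s_W = s_d = 0`, `t = 1`, `s = 0`: `m = v₂(c)`
  have hsW : padicValNat 2 (Nat.card (AddCommGroup.primaryComponent W.sha 2)) = 0 :=
    padicValNat_card_primaryComponent_sha_two_eq_zero_of_shaTwoTrivial W hSha
  obtain ⟨-, -, hbotd⟩ := twist_arith_of_selmerTrivial W hD0 hsel Wd Cd hWd
  have hsd : padicValNat 2 (Nat.card (AddCommGroup.primaryComponent Wd.sha 2)) = 0 := by
    rw [hbotd, AddSubgroup.card_bot]; simp
  rw [hsW, hsd, if_pos hΔ] at hlaw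
  rw [if_pos hΔ] at hmin
  have hmv : m = padicValInt 2 Dt.c := by omega
  rw [← hmv]
  exact hm

/-- **R⁻_float FROM `BSD₂` ON {`Δ_W < 0`, `Ш(W)[2] = 0`}**, modulo the four primary printed facts, the route's four rank-`0` cruxes BY NAME and the
reduction-type-free rank-`0` `2`-converse `hconv` (OPEN at `2`): for every curve of the slice with `Δ_W < 0`, `Ш(W)[2] = 0` and `BSDp W 2`, at every `Sel₂`-trivial
transposition-admissible prime door the Heegner point over any datum has exponent `v₂(c)`.  So R⁻_float is not a strengthening of the crux on its class.
CONDITIONAL by design; BSD is not proved by this. [cite: Zhang2014CJM, Thm. 1.1] [cite: BurungaleSkinnerTianWan2024, Thm. 4.3 (p odd)] -/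
theorem negDiscFloat_of_bsdTwo_on_class_of_twoConverse
    (hGZ : ∀ (N : ℕ) [NeZero N] (W : WeierstrassCurve ℚ) (K : Type) [Field K] [NumberField K], gross_zagier N W K)
    (hKo : ∀ (N : ℕ) [NeZero N] (W : WeierstrassCurve ℚ) (K : Type) [Field K] [NumberField K], kolyvagin N W K)
    (hnf : exists_isNewformOf) (hHL : HoffsteinLuo1997_exists_twist_L_one_ne_zero)
    (hZ4 : GoodOrdinaryRankZeroAtTwo ∧ MultiplicativeRankZeroAtTwo ∧ SupersingularRankZeroAtTwo ∧ AdditiveRankZeroAtTwo)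
    (hconv : ∀ (V : WeierstrassCurve ℚ) [V.IsElliptic] [V.IsGloballyMinimal], ¬ V.HasCM → V.selmerCorank 2 = 0 → V.analyticRank = 0)
    (hBcls : ∀ (W : WeierstrassCurve ℚ) [W.IsElliptic] [W.IsGloballyMinimal] [NeZero (W.conductorNorm ℤ)],
      ¬ W.HasCM → (∀ n : ℕ, W.HasSurjectiveModNGaloisRep ((2 ^ n : ℕ) : ℤ)) → Odd W.torsionOrder → Odd W.tamagawaProduct →
      W.analyticRank = 1 → W.Δ < 0 → ShaTwoTrivial W → BSDp W 2) :
    ∀ (W : WeierstrassCurve ℚ) [W.IsElliptic] [W.IsGloballyMinimal] [NeZero (W.conductorNorm ℤ)],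
      ¬ W.HasCM → (∀ n : ℕ, W.HasSurjectiveModNGaloisRep ((2 ^ n : ℕ) : ℤ)) → Odd W.torsionOrder → Odd W.tamagawaProduct →
      W.analyticRank = 1 → W.Δ < 0 → ShaTwoTrivial W →
      ∀ (K : Type) [Field K] [NumberField K], IsImaginaryQuadratic K →
        ∀ (q₀ : ℕ) [Fact q₀.Prime], TranspAdmissible W (NumberField.discr K) q₀ → twistSelmerTwoCard W (NumberField.discr K) = 1 →
          ∀ (Dt : ModularParametrizationData W (W.conductorNorm ℤ)) (H : HeegnerDatum (W.conductorNorm ℤ) (NumberField.discr K)) (ι : K →+* ℂ)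
            (P : (W.baseChange K).toAffine.Point),
            WeierstrassCurve.Affine.Point.map ι.toRatAlgHom P = heegnerPointComplex Dt H →
            HasTwoDivisibilityUpToTorsion W K P (padicValInt 2 Dt.c) := by
  intro W _ _ _ hCM hsurj hT hc hr hΔ hSha K _ _ hK q₀ _ htr hsel Dt H ι P hP
  have hB : BSDp W 2 := hBcls W hCM hsurj hT hc hr hΔ hSha
  have hD0 : (NumberField.discr K : ℚ) ≠ 0 := by exact_mod_cast NumberField.discr_ne_zero K
  haveI hEt : (W.quadraticTwist (NumberField.discr K : ℚ)).IsElliptic := W.isElliptic_quadraticTwist hD0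
  obtain ⟨Cd, hCd⟩ := hasGlobalMinimalModel_rat_holds (W.quadraticTwist (NumberField.discr K : ℚ))
  haveI := hCd
  exact exponent_eq_padicVal_of_bsdp_two_of_twoConverse_at hGZ hKo hnf hHL (fun V _ _ hVCM hV0 => bsdp_two_of_rankZero_cruxes hZ4 V hVCM hV0)
    W hCM hT hc hr hΔ hSha hB K hK q₀ htr hsel Dt H ι P hP (Cd • W.quadraticTwist (NumberField.discr K : ℚ)) Cd rfl (fun hVCM hV0 => hconv _ hVCM hV0)

/-- **R⁻_float FROM THE CRUX** (modulo PRINT⁴ + rank-`0` cruxes + the rank-`0` `2`-converse): together with `bsdp_two_of_negDiscFloat` this makes R⁻_float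
EQUIVALENT to `BSD₂` on {`Δ_W < 0`, `Ш(W)[2] = 0`} ∩ slice modulo those inputs — a lossless AND Manin-free restatement of the `Δ_W < 0` half of the residue.
CONDITIONAL by design; BSD is not proved by this. [cite: Zhang2014CJM, Thm. 1.1] [cite: GrossLMS1991, Conj. 1.2 and §10] -/
theorem negDiscFloat_of_rankOneAtTwoBigImageOddLocal_of_twoConverse
    (hGZ : ∀ (N : ℕ) [NeZero N] (W : WeierstrassCurve ℚ) (K : Type) [Field K] [NumberField K], gross_zagier N W K)
    (hKo : ∀ (N : ℕ) [NeZero N] (W : WeierstrassCurve ℚ) (K : Type) [Field K] [NumberField K], kolyvagin N W K)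
    (hnf : exists_isNewformOf) (hHL : HoffsteinLuo1997_exists_twist_L_one_ne_zero)
    (hZ4 : GoodOrdinaryRankZeroAtTwo ∧ MultiplicativeRankZeroAtTwo ∧ SupersingularRankZeroAtTwo ∧ AdditiveRankZeroAtTwo)
    (hconv : ∀ (V : WeierstrassCurve ℚ) [V.IsElliptic] [V.IsGloballyMinimal], ¬ V.HasCM → V.selmerCorank 2 = 0 → V.analyticRank = 0)
    (hX : RankOneAtTwoBigImageOddLocal) :
    ∀ (W : WeierstrassCurve ℚ) [W.IsElliptic] [W.IsGloballyMinimal] [NeZero (W.conductorNorm ℤ)],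
      ¬ W.HasCM → (∀ n : ℕ, W.HasSurjectiveModNGaloisRep ((2 ^ n : ℕ) : ℤ)) → Odd W.torsionOrder → Odd W.tamagawaProduct →
      W.analyticRank = 1 → W.Δ < 0 → ShaTwoTrivial W →
      ∀ (K : Type) [Field K] [NumberField K], IsImaginaryQuadratic K →
        ∀ (q₀ : ℕ) [Fact q₀.Prime], TranspAdmissible W (NumberField.discr K) q₀ → twistSelmerTwoCard W (NumberField.discr K) = 1 →
          ∀ (Dt : ModularParametrizationData W (W.conductorNorm ℤ)) (H : HeegnerDatum (W.conductorNorm ℤ) (NumberField.discr K)) (ι : K →+* ℂ)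
            (P : (W.baseChange K).toAffine.Point),
            WeierstrassCurve.Affine.Point.map ι.toRatAlgHom P = heegnerPointComplex Dt H →
            HasTwoDivisibilityUpToTorsion W K P (padicValInt 2 Dt.c) :=
  negDiscFloat_of_bsdTwo_on_class_of_twoConverse hGZ hKo hnf hHL hZ4 hconv (fun W _ _ _ hCM hsurj hT hc hr _ _ => hX W hCM hsurj hT hc hr)

end Summit.BirchSwinnertonDyer.BirchSwinnertonDyer.Theorems.RankOneAtTwoOneDoor

end
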